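/-
Copyright (c) 2026 the pub-hodgecm-mathlib formalisation cell (harness21).  Prover seat hodgecm-mathlib-K2E5-p16 (g4): Track B «K2-LIT»,
hLiu418 = stmt-HodgeConjecture-24832, ROAD Φ organ Φ6b-1⁺ (self-offered under LEAD F0P6-plan (g12) ∕ co-dealer K2E5-plan (g5)): HOLOMORPHY of
Shimura's `ξ(g, h; α, β)` along complex lines `(α, β) = (α₀ + u s, β₀ + v s)` in its region of absolute convergence; 2026-09-04.
-/
import Summits.HodgeConjecture.HodgeConjecture.Theorems.K2LiuHermTwoConfluentXiRegularity   -- ★ (this seat): `det g ≤ |det(g+ix)|`, domination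
import Mathlib.Analysis.Calculus.ParametricIntegral
import Mathlib.Analysis.SpecialFunctions.Complex.LogDeriv
import Literature.Dynamics.TransferOperators.MayerTransferOperatorHolomorphy                 -- ★ `rpow_neg_le_add`
import HarnessLib

/-!
# Crux `HLiu418`, ROAD Φ, organ Φ6b-1⁺: holomorphy of `s ↦ ξ(g, h; α₀ + u s, β₀ + v s)` on `re(α + β) > 3`

Cell `hodgecm-mathlib`, crux item hLiu418 = `stmt-HodgeConjecture-24832`, route of record `HCCMUnconditional`; squad K2, LEAD F0P6-plan (g12), co-dealer
K2E5-plan (g5) (CENSUS-41 row Φ6: the archimedean Whittaker coefficient is `ξ(y, β; s + a, s + b)` — holomorphy IN `s` is what Road Φ consumes),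
prover K2E5-p16 (g4).  THEOREMS ONLY (no `def`, no instance, no notation, no named-fact hypothesis, no `sorry`, default heartbeats); lane
`--supports stmt-HodgeConjecture-24832 --as helper` (count-neutral helper).

WHAT IS PROVED.  For `g` positive definite, `h` Hermitian (`2 × 2` complex), `α₀ β₀ u v : ℂ`:
* `xiTwoIntegrand_affine` — along the line, the integrand is `K(x) · exp(s Λ(x))` with
  `Λ(x) = πi(v − u) − u log det(g − ix) − v log det(g + ix)` (principal logs; `det ≠ 0` by ★ `norm_det_add_I_smul_pos`);
* `hasDerivAt_xiTwoIntegrand_affine` — `d/ds` of the integrand is `Λ(x) ·` integrand;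
* elementary bounds `abs_log_le_of_le` (`|log x| ≤ |log δ| + x^η/η` for `x ≥ δ > 0`), `norm_log_le` (`‖log z‖ ≤ |log‖z‖| + π`),
  ★ `Literature.Dynamics.TransferOperators.rpow_neg_le_add` (imported), `norm_lineCoeff_le` (`‖Λ(x)‖ ≤ A + B|det(g+ix)|^η`);
* `hasDerivAt_xiTwo_affine` — **`s ↦ ξ(g, h; α₀ + u s, β₀ + v s)` HAS A COMPLEX DERIVATIVE at every `s₀` with `re(α₀ + β₀ + (u+v)s₀) > 3`**,
  namely `∫ Λ(x) · ξ-integrand dx` (differentiation under the integral sign, ★ `hasDerivAt_integral_of_dominated_loc_of_deriv_le`, dominated on a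
  ball by `C·Σ |det(g+ix)|^{−tᵢ}` with all `tᵢ > 3`, integrable by ★ `integrable_norm_det_add_I_smul_rpow_neg`);
* `differentiableOn_xiTwo_affine` — holomorphy on the open set `{s | 3 < re(α₀ + β₀ + (u+v)s)}`; `differentiableOn_xiTwo_diag` — the case
  `u = v = 1` of Road Φ (`W(s) = ξ(y, β; s + a, s + b)`).
NOT here: the continuation beyond the region of absolute convergence (print-gated, acq-15212).
HONEST LABEL.  Count-neutral helper of the K2_Liu road; it pays no socket by itself: `HC_CM` is proved only modulo the 7 printed citations
(2 remaining named inputs: hLiu418 = `stmt-HodgeConjecture-24832`, h413 = `stmt-HodgeConjecture-24833`) until rung 0 closes.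
References (orientation only): [Shimura1982] §1 (1.25)–(1.29), §3.
-/

set_option autoImplicit false
-- the mandated namespace repeats the single-problem summit's segment (`HodgeConjecture.HodgeConjecture`)
set_option linter.dupNamespace false

noncomputable section

open Complex MeasureTheory Set
open scoped ComplexOrder ComplexConjugate

namespace Summit.HodgeConjecture.HodgeConjecture.Cruxes.HLiu418.K2LiuHermTwoConfluentXiHolomorphy

open Summit.HodgeConjecture.HodgeConjecture.Cruxes.HLiu418.K2LiuHermTwoGammaDefs
open Summit.HodgeConjecture.HodgeConjecture.Cruxes.HLiu418.K2LiuHermTwoDetPowerFibres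
open Summit.HodgeConjecture.HodgeConjecture.Cruxes.HLiu418.K2LiuHermTwoDetPowerIntegrable
open Summit.HodgeConjecture.HodgeConjecture.Cruxes.HLiu418.K2LiuHermTwoConfluentXiDefs
open Summit.HodgeConjecture.HodgeConjecture.Cruxes.HLiu418.K2LiuHermTwoConfluentXiConvergence
open Summit.HodgeConjecture.HodgeConjecture.Cruxes.HLiu418.K2LiuHermTwoConfluentXiRegularity

/-! ## Elementary bounds -/

/-- `|log x| ≤ |log δ| + x^η/η` for `x ≥ δ > 0`, `η > 0`. -/
theorem abs_log_le_of_le {δ x η : ℝ} (hδ : 0 < δ) (hx : δ ≤ x) (hη : 0 < η) :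
    |Real.log x| ≤ |Real.log δ| + x ^ η / η := by
  have hx0 : 0 < x := lt_of_lt_of_le hδ hx
  have h1 : Real.log x ≤ x ^ η / η := Real.log_le_rpow_div hx0.le hη
  have h2 : Real.log δ ≤ Real.log x := Real.log_le_log hδ hx
  have h3 : 0 ≤ x ^ η / η := div_nonneg (Real.rpow_nonneg hx0.le _) hη.le
  rw [abs_le]
  constructor
  · linarith [neg_abs_le (Real.log δ)]
  · linarith [abs_nonneg (Real.log δ)]

/-- `‖log z‖ ≤ |log ‖z‖| + π` (principal logarithm). -/
theorem norm_log_le (z : ℂ) : ‖Complex.log z‖ ≤ |Real.log ‖z‖| + Real.pi := by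
  calc ‖Complex.log z‖ ≤ |(Complex.log z).re| + |(Complex.log z).im| := Complex.norm_le_abs_re_add_abs_im _
    _ = |Real.log ‖z‖| + |arg z| := by rw [Complex.log_re, Complex.log_im]
    _ ≤ |Real.log ‖z‖| + Real.pi := by linarith [Complex.abs_arg_le_pi z]

-- `x^{−t} ≤ x^{−t₁} + x^{−t₂}` for `t ∈ [t₁, t₂]` is ★ `Literature.Dynamics.TransferOperators.rpow_neg_le_add` (imported).

/-! ## The integrand along a complex line `(α, β) = (α₀ + u s, β₀ + v s)` -/

/-- Along the line the integrand factorises as `K(x) · exp(s Λ(x))`, `K` = the integrand at `(α₀, β₀)`,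
`Λ(x) = πi(v − u) − u log det(g − ix) − v log det(g + ix)`. -/
theorem xiTwoIntegrand_affine {g h : Matrix (Fin 2) (Fin 2) ℂ} (hg : g.PosDef) (α₀ β₀ u v s : ℂ) (c : ℝ × ℂ × ℝ) :
    xiTwoIntegrand g h (α₀ + u * s) (β₀ + v * s) c =
      xiTwoIntegrand g h α₀ β₀ c *
        cexp (s * ((Real.pi * I) * (v - u) - u * Complex.log ((g - I • hermTwo c).det) -
          v * Complex.log ((g + I • hermTwo c).det))) := by
  have hD : (g + I • hermTwo c).det ≠ 0 := norm_pos_iff.mp (norm_det_add_I_smul_pos hg c)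
  have hDm : (g - I • hermTwo c).det ≠ 0 := by
    rw [det_sub_I_smul_eq_conj hg c]
    exact (map_ne_zero _).mpr hD
  rw [xiTwoIntegrand_eq, xiTwoIntegrand_eq, cpow_def_of_ne_zero hDm, cpow_def_of_ne_zero hDm, cpow_def_of_ne_zero hD,
    cpow_def_of_ne_zero hD]
  set Lm := Complex.log ((g - I • hermTwo c).det)
  set Lp := Complex.log ((g + I • hermTwo c).det)
  rw [show (Real.pi * I) * (β₀ + v * s - (α₀ + u * s)) = (Real.pi * I) * (β₀ - α₀) + (Real.pi * I) * (v - u) * s by ring,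
    Complex.exp_add,
    show Lm * -(α₀ + u * s) = Lm * -α₀ + -(u * Lm) * s by ring, Complex.exp_add,
    show Lp * -(β₀ + v * s) = Lp * -β₀ + -(v * Lp) * s by ring, Complex.exp_add,
    show s * ((Real.pi * I) * (v - u) - u * Lm - v * Lp) = (Real.pi * I) * (v - u) * s + -(u * Lm) * s + -(v * Lp) * s by ring,
    Complex.exp_add, Complex.exp_add]
  ring

/-- The `s`-derivative of the integrand along the line: `Λ(x) ·` integrand. -/
theorem hasDerivAt_xiTwoIntegrand_affine {g h : Matrix (Fin 2) (Fin 2) ℂ} (hg : g.PosDef) (α₀ β₀ u v : ℂ) (c : ℝ × ℂ × ℝ) (s : ℂ) :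
    HasDerivAt (fun s : ℂ => xiTwoIntegrand g h (α₀ + u * s) (β₀ + v * s) c)
      (xiTwoIntegrand g h (α₀ + u * s) (β₀ + v * s) c *
        ((Real.pi * I) * (v - u) - u * Complex.log ((g - I • hermTwo c).det) - v * Complex.log ((g + I • hermTwo c).det))) s := by
  have hfun : (fun s : ℂ => xiTwoIntegrand g h (α₀ + u * s) (β₀ + v * s) c) =
      fun s => xiTwoIntegrand g h α₀ β₀ c * cexp (s * ((Real.pi * I) * (v - u) - u * Complex.log ((g - I • hermTwo c).det) -
        v * Complex.log ((g + I • hermTwo c).det))) := by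
    funext s
    exact xiTwoIntegrand_affine hg α₀ β₀ u v s c
  rw [hfun, xiTwoIntegrand_affine hg α₀ β₀ u v s c]
  have h1 : HasDerivAt (fun s : ℂ => cexp (s * ((Real.pi * I) * (v - u) - u * Complex.log ((g - I • hermTwo c).det) -
        v * Complex.log ((g + I • hermTwo c).det))))
      (cexp (s * ((Real.pi * I) * (v - u) - u * Complex.log ((g - I • hermTwo c).det) - v * Complex.log ((g + I • hermTwo c).det))) *
        ((Real.pi * I) * (v - u) - u * Complex.log ((g - I • hermTwo c).det) - v * Complex.log ((g + I • hermTwo c).det))) s :=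
    (hasDerivAt_mul_const _).cexp
  have h2 := h1.const_mul (xiTwoIntegrand g h α₀ β₀ c)
  exact h2.congr_deriv (by ring)

/-- The bound on the line coefficient: `‖Λ(x)‖ ≤ π‖v − u‖ + (‖u‖ + ‖v‖)(π + |log det g| + |det(g+ix)|^η/η)` (`η > 0`), using
`det g ≤ |det(g ± ix)|`. -/
theorem norm_lineCoeff_le {g : Matrix (Fin 2) (Fin 2) ℂ} (hg : g.PosDef) (u v : ℂ) {η : ℝ} (hη : 0 < η) (c : ℝ × ℂ × ℝ) :
    ‖(Real.pi * I) * (v - u) - u * Complex.log ((g - I • hermTwo c).det) - v * Complex.log ((g + I • hermTwo c).det)‖ ≤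
      Real.pi * ‖v - u‖ + (‖u‖ + ‖v‖) *
        (Real.pi + |Real.log ((g 0 0).re * (g 1 1).re - normSq (g 0 1))| + ‖(g + I • hermTwo c).det‖ ^ η / η) := by
  have hδ := det_re_pos_of_posDef hg
  have hle := det_le_norm_det_add_I_smul hg c
  have hnm : ‖(g - I • hermTwo c).det‖ = ‖(g + I • hermTwo c).det‖ := by
    rw [det_sub_I_smul_eq_conj hg c, Complex.norm_conj]
  have hlog : |Real.log ‖(g + I • hermTwo c).det‖| ≤
      |Real.log ((g 0 0).re * (g 1 1).re - normSq (g 0 1))| + ‖(g + I • hermTwo c).det‖ ^ η / η :=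
    abs_log_le_of_le hδ hle hη
  have hLp : ‖Complex.log ((g + I • hermTwo c).det)‖ ≤
      Real.pi + |Real.log ((g 0 0).re * (g 1 1).re - normSq (g 0 1))| + ‖(g + I • hermTwo c).det‖ ^ η / η := by
    have := norm_log_le ((g + I • hermTwo c).det)
    linarith
  have hLm : ‖Complex.log ((g - I • hermTwo c).det)‖ ≤
      Real.pi + |Real.log ((g 0 0).re * (g 1 1).re - normSq (g 0 1))| + ‖(g + I • hermTwo c).det‖ ^ η / η := by
    have := norm_log_le ((g - I • hermTwo c).det)
    rw [hnm] at this
    linarith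
  have hπ : ‖(Real.pi : ℂ) * I * (v - u)‖ = Real.pi * ‖v - u‖ := by
    rw [norm_mul, norm_mul, Complex.norm_real, Complex.norm_I, mul_one, Real.norm_of_nonneg Real.pi_pos.le]
  calc ‖(Real.pi * I) * (v - u) - u * Complex.log ((g - I • hermTwo c).det) - v * Complex.log ((g + I • hermTwo c).det)‖
      ≤ ‖(Real.pi * I) * (v - u)‖ + ‖u * Complex.log ((g - I • hermTwo c).det)‖ + ‖v * Complex.log ((g + I • hermTwo c).det)‖ := by
        have h1 := norm_sub_le ((Real.pi * I) * (v - u) - u * Complex.log ((g - I • hermTwo c).det))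
          (v * Complex.log ((g + I • hermTwo c).det))
        have h2 := norm_sub_le ((Real.pi * I) * (v - u)) (u * Complex.log ((g - I • hermTwo c).det))
        linarith
    _ = Real.pi * ‖v - u‖ + ‖u‖ * ‖Complex.log ((g - I • hermTwo c).det)‖ + ‖v‖ * ‖Complex.log ((g + I • hermTwo c).det)‖ := by
        rw [hπ, norm_mul, norm_mul]
    _ ≤ Real.pi * ‖v - u‖ + (‖u‖ + ‖v‖) *
        (Real.pi + |Real.log ((g 0 0).re * (g 1 1).re - normSq (g 0 1))| + ‖(g + I • hermTwo c).det‖ ^ η / η) := by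
        nlinarith [mul_le_mul_of_nonneg_left hLm (norm_nonneg u), mul_le_mul_of_nonneg_left hLp (norm_nonneg v)]

/-! ## Differentiation under the integral sign -/

/-- **HOLOMORPHY OF `ξ` ALONG COMPLEX LINES** (organ Φ6b-1⁺): for `g` positive definite, `h` Hermitian and `α₀ β₀ u v : ℂ`, at every `s₀` with
`re(α₀ + u s₀ + β₀ + v s₀) > 3` the function `s ↦ ξ(g, h; α₀ + u s, β₀ + v s)` has the complex derivative
`∫ (ξ-integrand)·Λ(x) dx` (differentiation under the integral sign). -/
theorem hasDerivAt_xiTwo_affine {g h : Matrix (Fin 2) (Fin 2) ℂ} (hg : g.PosDef) (hh : h.IsHermitian) (α₀ β₀ u v : ℂ) {s₀ : ℂ}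
    (hs₀ : 3 < (α₀ + u * s₀ + (β₀ + v * s₀)).re) :
    HasDerivAt (fun s : ℂ => xiTwo g h (α₀ + u * s) (β₀ + v * s))
      (∫ c : ℝ × ℂ × ℝ, xiTwoIntegrand g h (α₀ + u * s₀) (β₀ + v * s₀) c *
        ((Real.pi * I) * (v - u) - u * Complex.log ((g - I • hermTwo c).det) - v * Complex.log ((g + I • hermTwo c).det))) s₀ := by
  -- constants
  set t₀ : ℝ := (α₀ + u * s₀ + (β₀ + v * s₀)).re with ht₀
  set ε : ℝ := (t₀ - 3) / (2 * (‖u + v‖ + 1)) with hε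
  set η : ℝ := (t₀ - 3) / 4 with hη
  have ht₀3 : 0 < t₀ - 3 := by linarith
  have hεpos : 0 < ε := by positivity
  have hηpos : 0 < η := by positivity
  have hεuv : ‖u + v‖ * ε ≤ (t₀ - 3) / 2 := by
    rw [hε]
    have h1 : 0 ≤ ‖u + v‖ := norm_nonneg _
    rw [show ‖u + v‖ * ((t₀ - 3) / (2 * (‖u + v‖ + 1))) = (t₀ - 3) / 2 * (‖u + v‖ / (‖u + v‖ + 1)) by
      field_simp]
    have h2 : ‖u + v‖ / (‖u + v‖ + 1) ≤ 1 := (div_le_one (by positivity)).mpr (by linarith)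
    nlinarith
  set t₁ : ℝ := t₀ - ‖u + v‖ * ε with ht₁
  set t₂ : ℝ := t₀ + ‖u + v‖ * ε with ht₂
  have ht₁3 : 3 < t₁ - η := by
    rw [ht₁, hη]
    linarith
  have hδ := det_re_pos_of_posDef hg
  set δ : ℝ := (g 0 0).re * (g 1 1).re - normSq (g 0 1) with hδdef
  set M : ℝ := ‖α₀‖ + ‖β₀‖ + (‖u‖ + ‖v‖) * (‖s₀‖ + ε) with hM
  set A : ℝ := Real.pi * ‖v - u‖ + (‖u‖ + ‖v‖) * (Real.pi + |Real.log δ|) with hA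
  set B : ℝ := (‖u‖ + ‖v‖) / η with hB
  have hA0 : 0 ≤ A := by positivity
  have hB0 : 0 ≤ B := by positivity
  -- the data of the dominated-differentiation lemma
  refine (hasDerivAt_integral_of_dominated_loc_of_deriv_le (μ := (volume : Measure (ℝ × ℂ × ℝ)))
    (F := fun s c => xiTwoIntegrand g h (α₀ + u * s) (β₀ + v * s) c)
    (F' := fun s c => xiTwoIntegrand g h (α₀ + u * s) (β₀ + v * s) c *
      ((Real.pi * I) * (v - u) - u * Complex.log ((g - I • hermTwo c).det) - v * Complex.log ((g + I • hermTwo c).det)))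
    (bound := fun c => Real.exp (2 * Real.pi * M) *
      (A * (‖(g + I • hermTwo c).det‖ ^ (-t₁) + ‖(g + I • hermTwo c).det‖ ^ (-t₂)) +
        B * (‖(g + I • hermTwo c).det‖ ^ (-(t₁ - η)) + ‖(g + I • hermTwo c).det‖ ^ (-(t₂ - η)))))
    (Metric.ball_mem_nhds s₀ hεpos) ?_ ?_ ?_ ?_ ?_ ?_).2
  · -- measurability of `F s` near `s₀`
    exact Filter.Eventually.of_forall fun s => aestronglyMeasurable_xiTwoIntegrand g h _ _
  · -- integrability at `s₀`
    exact integrable_xiTwoIntegrand hg hh hs₀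
  · -- measurability of `F' s₀`
    refine ((measurable_xiTwoIntegrand g h _ _).mul ?_).aestronglyMeasurable
    refine Measurable.sub (Measurable.sub measurable_const ?_) ?_
    · exact measurable_const.mul (Complex.measurable_log.comp (continuous_det_sub_I_smul_hermTwo g).measurable)
    · exact measurable_const.mul (Complex.measurable_log.comp (continuous_det_add_I_smul_hermTwo g).measurable)
  · -- THE DOMINATION on the ball
    refine Filter.Eventually.of_forall fun c s hs => ?_
    have hsd : ‖s - s₀‖ < ε := by
      rw [← dist_eq_norm]
      exact hs
    have hs' : ‖s‖ ≤ ‖s₀‖ + ε := by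
      have := norm_sub_norm_le s s₀
      linarith
    have hDpos : 0 < ‖(g + I • hermTwo c).det‖ := norm_det_add_I_smul_pos hg c
    set nD : ℝ := ‖(g + I • hermTwo c).det‖ with hnD
    -- (i) the exponential factor
    have him : |(α₀ + u * s).im| + |(β₀ + v * s).im| ≤ M := by
      have h1 : |(α₀ + u * s).im| ≤ ‖α₀‖ + ‖u‖ * (‖s₀‖ + ε) := by
        calc |(α₀ + u * s).im| ≤ ‖α₀ + u * s‖ := Complex.abs_im_le_norm _
          _ ≤ ‖α₀‖ + ‖u * s‖ := norm_add_le _ _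
          _ = ‖α₀‖ + ‖u‖ * ‖s‖ := by rw [norm_mul]
          _ ≤ ‖α₀‖ + ‖u‖ * (‖s₀‖ + ε) := by gcongr
      have h2 : |(β₀ + v * s).im| ≤ ‖β₀‖ + ‖v‖ * (‖s₀‖ + ε) := by
        calc |(β₀ + v * s).im| ≤ ‖β₀ + v * s‖ := Complex.abs_im_le_norm _
          _ ≤ ‖β₀‖ + ‖v * s‖ := norm_add_le _ _
          _ = ‖β₀‖ + ‖v‖ * ‖s‖ := by rw [norm_mul]
          _ ≤ ‖β₀‖ + ‖v‖ * (‖s₀‖ + ε) := by gcongr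
      rw [hM]
      linarith
    have hexp : Real.exp (2 * Real.pi * (|(α₀ + u * s).im| + |(β₀ + v * s).im|)) ≤ Real.exp (2 * Real.pi * M) := by
      refine Real.exp_le_exp.mpr ?_
      exact mul_le_mul_of_nonneg_left him (by positivity)
    -- (ii) the exponent range
    have ht : t₁ ≤ (α₀ + u * s + (β₀ + v * s)).re ∧ (α₀ + u * s + (β₀ + v * s)).re ≤ t₂ := by
      have hdiff : (α₀ + u * s + (β₀ + v * s)).re = t₀ + ((u + v) * (s - s₀)).re := by
        rw [ht₀]
        simp only [add_re, add_im, mul_re, sub_re, sub_im]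
        ring
      have hbd : |((u + v) * (s - s₀)).re| ≤ ‖u + v‖ * ε := by
        calc |((u + v) * (s - s₀)).re| ≤ ‖(u + v) * (s - s₀)‖ := Complex.abs_re_le_norm _
          _ = ‖u + v‖ * ‖s - s₀‖ := norm_mul _ _
          _ ≤ ‖u + v‖ * ε := mul_le_mul_of_nonneg_left hsd.le (norm_nonneg _)
      rw [hdiff, ht₁, ht₂]
      constructor <;> linarith [le_abs_self ((u + v) * (s - s₀)).re, neg_abs_le ((u + v) * (s - s₀)).re]
    have hpow : nD ^ (-(α₀ + u * s + (β₀ + v * s)).re) ≤ nD ^ (-t₁) + nD ^ (-t₂) :=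
      Literature.Dynamics.TransferOperators.rpow_neg_le_add hDpos ht.1 ht.2
    -- (iii) the integrand and the coefficient
    have hF : ‖xiTwoIntegrand g h (α₀ + u * s) (β₀ + v * s) c‖ ≤ Real.exp (2 * Real.pi * M) * (nD ^ (-t₁) + nD ^ (-t₂)) :=
      (norm_xiTwoIntegrand_le hg hh _ _ c).trans (mul_le_mul hexp hpow (Real.rpow_nonneg hDpos.le _) (Real.exp_pos _).le)
    have hΛ : ‖(Real.pi * I) * (v - u) - u * Complex.log ((g - I • hermTwo c).det) - v * Complex.log ((g + I • hermTwo c).det)‖ ≤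
        A + B * nD ^ η := by
      have := norm_lineCoeff_le hg u v hηpos c
      rw [hA, hB]
      have hrw : Real.pi * ‖v - u‖ + (‖u‖ + ‖v‖) * (Real.pi + |Real.log δ| + nD ^ η / η) =
          Real.pi * ‖v - u‖ + (‖u‖ + ‖v‖) * (Real.pi + |Real.log δ|) + (‖u‖ + ‖v‖) / η * nD ^ η := by
        field_simp
        ring
      rw [← hrw]
      exact this
    -- (iv) assemble
    have hprod : (Real.exp (2 * Real.pi * M) * (nD ^ (-t₁) + nD ^ (-t₂))) * (A + B * nD ^ η) =
        Real.exp (2 * Real.pi * M) * (A * (nD ^ (-t₁) + nD ^ (-t₂)) + B * (nD ^ (-(t₁ - η)) + nD ^ (-(t₂ - η)))) := by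
      rw [show -(t₁ - η) = -t₁ + η by ring, show -(t₂ - η) = -t₂ + η by ring, Real.rpow_add hDpos, Real.rpow_add hDpos]
      ring
    calc ‖xiTwoIntegrand g h (α₀ + u * s) (β₀ + v * s) c *
          ((Real.pi * I) * (v - u) - u * Complex.log ((g - I • hermTwo c).det) - v * Complex.log ((g + I • hermTwo c).det))‖
        = ‖xiTwoIntegrand g h (α₀ + u * s) (β₀ + v * s) c‖ *
            ‖(Real.pi * I) * (v - u) - u * Complex.log ((g - I • hermTwo c).det) - v * Complex.log ((g + I • hermTwo c).det)‖ :=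
          norm_mul _ _
      _ ≤ (Real.exp (2 * Real.pi * M) * (nD ^ (-t₁) + nD ^ (-t₂))) * (A + B * nD ^ η) :=
          mul_le_mul hF hΛ (norm_nonneg _) (by positivity)
      _ = _ := hprod
  · -- integrability of the bound
    have h1 := integrable_norm_det_add_I_smul_rpow_neg hg (σ := t₁) (by linarith)
    have h2 := integrable_norm_det_add_I_smul_rpow_neg hg (σ := t₂) (by rw [ht₂]; nlinarith [norm_nonneg (u + v)])
    have h3 := integrable_norm_det_add_I_smul_rpow_neg hg (σ := t₁ - η) ht₁3
    have h4 := integrable_norm_det_add_I_smul_rpow_neg hg (σ := t₂ - η) (by rw [ht₂]; nlinarith [norm_nonneg (u + v)])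
    exact (((h1.add h2).const_mul A).add ((h3.add h4).const_mul B)).const_mul _
  · -- the pointwise derivative
    exact Filter.Eventually.of_forall fun c s _ => hasDerivAt_xiTwoIntegrand_affine hg α₀ β₀ u v c s

/-- **`ξ` IS HOLOMORPHIC ALONG COMPLEX LINES on its region of absolute convergence**: for `g > 0`, `h` Hermitian, `α₀ β₀ u v : ℂ`,
`s ↦ ξ(g, h; α₀ + u s, β₀ + v s)` is complex-differentiable on the open set `{s | 3 < re(α₀ + u s + β₀ + v s)}`. -/
theorem differentiableOn_xiTwo_affine {g h : Matrix (Fin 2) (Fin 2) ℂ} (hg : g.PosDef) (hh : h.IsHermitian) (α₀ β₀ u v : ℂ) :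
    DifferentiableOn ℂ (fun s : ℂ => xiTwo g h (α₀ + u * s) (β₀ + v * s)) {s : ℂ | 3 < (α₀ + u * s + (β₀ + v * s)).re} :=
  fun _ hs => (hasDerivAt_xiTwo_affine hg hh α₀ β₀ u v hs).differentiableAt.differentiableWithinAt

/-- The diagonal case of Road Φ (`W(s) = ξ(y, β; s + a, s + b)`): `s ↦ ξ(g, h; a + s, b + s)` is holomorphic on `{s | 3 < re(a + b + 2s)}`. -/
theorem differentiableOn_xiTwo_diag {g h : Matrix (Fin 2) (Fin 2) ℂ} (hg : g.PosDef) (hh : h.IsHermitian) (a b : ℂ) :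
    DifferentiableOn ℂ (fun s : ℂ => xiTwo g h (a + s) (b + s)) {s : ℂ | 3 < (a + b + 2 * s).re} := by
  intro s hs
  have hs' : 3 < (a + 1 * s + (b + 1 * s)).re := by
    simp only [Set.mem_setOf_eq] at hs
    have : a + 1 * s + (b + 1 * s) = a + b + 2 * s := by ring
    rw [this]
    exact hs
  have h := (hasDerivAt_xiTwo_affine hg hh a b 1 1 hs').differentiableAt
  simp only [one_mul] at h
  exact h.differentiableWithinAt

end Summit.HodgeConjecture.HodgeConjecture.Cruxes.HLiu418.K2LiuHermTwoConfluentXiHolomorphy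

end
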